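import Literature.MathematicalPhysics.QuantumLattice.GrassmannLinearSubstitution
import Literature.MathematicalPhysics.QuantumLattice.GrassmannKernelAntisymmetry
import HarnessLib

/-!
# Reading plain legs of a Gaussian step through SPECTATOR generators: `kernel_m (effAction (MᵀC′M) W)` at prescribed labels as the
# all-spectator kernel of a step in the enlarged algebra `Γ′ ⊕ ρ` with the input substituted by `ψ_q ↦ Σ_σ M σ q ψ′_σ + Σ_{a : p a = q} θ_a`

Topic `MathematicalPhysics/QuantumLattice`; continuation of `GrassmannLinearSubstitution` (`effAction_map`, `gaussConv_map`, `grassmannLaplacian_map`,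
`kernel_map`).  The device behind «external legs are never sectorised, internal lines are» (Benfatto–Giuliani–Mastropietro 2006, §2.7: the kernels
`W^{(h)}_{2n}(x)` keep plain external legs while every internal line of the tree expansion carries a sector, (2.70)–(2.71); Salmhofer 1999, App. B.2
(B.23)–(B.25): the Gaussian integral is covariant under linear substitutions).  If a covariance on the labels `Γ` FACTORS as `C = Mᵀ C′ M` through a
substitution matrix `M : Matrix Γ′ Γ R` (e.g. `Γ′` = momentum fields / sector fields, `C′` = the slice covariance there), then for any finite family of
SPECTATOR positions `p : ρ → Γ` the substitution `Ψ_p : ψ_q ↦ Σ_σ M σ q ψ′_σ + Σ_{a : p a = q} θ_a` into the algebra on `Γ′ ⊕ ρ` (matrix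
`fromRows M (δ_{p a, q})`) pulls the block covariance `fromBlocks C′ 0 0 0` (the spectators `θ_a` do not fluctuate) back to `C`; hence
`effAction (fromBlocks C′ 0 0 0) (Ψ_p W) = Ψ_p (effAction C W)` and, reading the result at an all-spectator string `inr ∘ a`,
**`kernel_m (effAction C W) (p ∘ a) = kernel_m (effAction (fromBlocks C′ 0 0 0) (Ψ_p W)) (inr ∘ a)`** — the PLAIN legs `p (a i)` of the step's output are
the spectator legs of a step whose vertex `Ψ_p W` has MIXED kernels (spectator legs pinned at the `p a`, the other legs `M`-substituted) and whose lines
run between `Γ′`-legs only.  Since `θ_a² = 0`, no kernel of `Ψ_p W` carries a spectator twice: with `ρ = Fin 2` at most two plain legs ever appear — the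
«anchored mixed plain/substituted norm» of the two-leg read-out.  The same holds for `gaussConv`, `grassmannLaplacian` and for the three pieces
`Δ_C W`, `e^{Δ_C}W − W − Δ_C W`, `effAction C W − e^{Δ_C}W` of one step.

* `fromRows_transpose_mul_fromBlocks_mul_fromRows` — `(fromRows M B)ᵀ · fromBlocks C′ 0 0 0 · fromRows M B = Mᵀ C′ M` (any second block `B`);
* `effAction_fromBlocks_map_fromRows`, `gaussConv_fromBlocks_map_fromRows`, `grassmannLaplacian_fromBlocks_map_fromRows` — covariance of the step under `Ψ`;
* `kernel_map_fromRows` (the mixed kernels of `Ψ X`), **`kernel_map_fromRows_spectator_inr`** (`kernel_m (Ψ_p X) (inr ∘ a) = kernel_m X (p ∘ a)`);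
* **`kernel_effAction_eq_spectator`**, `kernel_gaussConv_eq_spectator`, `kernel_grassmannLaplacian_eq_spectator`, and the three-piece forms
  `kernel_gaussConv_sub_sub_laplacian_eq_spectator`, `kernel_effAction_sub_gaussConv_eq_spectator`.

Everything is proved; no definition, no named fact.

## Sources
G. Benfatto, A. Giuliani, V. Mastropietro, Ann. Henri Poincaré 7 (2006) 809–898, §2.2 (2.12), §2.7 (2.70)–(2.71) [`BenfattoGiulianiMastropietro2006`].
M. Salmhofer, *Renormalization: An Introduction* (Springer 1999), App. B.2 (B.23)–(B.25), §4.3 (4.88) [`Salmhofer1999`].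
-/

noncomputable section

namespace Literature.MathematicalPhysics.QuantumLattice

open GrassmannAlgebra Finset

section Spectator

variable (R : Type*) [CommRing R] {Γ Γ' ρ : Type*} [Fintype Γ] [DecidableEq Γ] [Fintype Γ'] [Fintype ρ]

omit [Fintype Γ] [DecidableEq Γ] in
/-- **The spectator substitution pulls the block covariance back to `Mᵀ C′ M`**: for any second block of rows `B`,
`(fromRows M B)ᵀ · fromBlocks C′ 0 0 0 · fromRows M B = Mᵀ · C′ · M` (the spectator rows see only zero blocks). [cite: Salmhofer1999, App. B.2 (B.23)-(B.25)] -/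
theorem fromRows_transpose_mul_fromBlocks_mul_fromRows (M : Matrix Γ' Γ R) (B : Matrix ρ Γ R) (C' : Matrix Γ' Γ' R) :
    (Matrix.fromRows M B).transpose * Matrix.fromBlocks C' (0 : Matrix Γ' ρ R) (0 : Matrix ρ Γ' R) (0 : Matrix ρ ρ R) * Matrix.fromRows M B =
      M.transpose * C' * M := by
  rw [Matrix.transpose_fromRows, Matrix.fromCols_mul_fromBlocks, Matrix.fromCols_mul_fromRows]
  simp

variable [Algebra ℚ R]

omit [Fintype Γ] [DecidableEq Γ] in
/-- Kernels of a difference (any commutative `ℚ`-algebra of coefficients). [cite: Salmhofer1999, §4.3 (4.95)] -/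
theorem kernel_sub_gen (A B : GrassmannAlgebra R Γ) (m : ℕ) (X : Fin m → Γ) :
    kernel R (A - B) m X = kernel R A m X - kernel R B m X := by
  rw [sub_eq_add_neg, kernel_add, ← neg_one_smul R B, kernel_smul, neg_one_mul, ← sub_eq_add_neg]

/-- **A kernel vanishes at a string with a repeated label** (`ψ_X² = 0`; total antisymmetry under the transposition of the two slots, and `2` is
invertible). [cite: Salmhofer1999, §4.3 (4.95)] -/
theorem kernel_eq_zero_of_not_injective (X : GrassmannAlgebra R Γ) {m : ℕ} {Y : Fin m → Γ} (hY : ¬Function.Injective Y) : kernel R X m Y = 0 := by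
  obtain ⟨i, j, hYij, hij⟩ : ∃ i j, Y i = Y j ∧ i ≠ j := by
    by_contra h
    push Not at h
    exact hY fun i j hY' => h i j hY'
  have hswap : Y ∘ ⇑(Equiv.swap i j) = Y := by
    funext k
    simp only [Function.comp_apply]
    rcases eq_or_ne k i with rfl | hki
    · rw [Equiv.swap_apply_left, hYij]
    · rcases eq_or_ne k j with rfl | hkj
      · rw [Equiv.swap_apply_right, hYij]
      · rw [Equiv.swap_apply_of_ne_of_ne hki hkj]
  have h := kernel_comp_perm R X m Y (Equiv.swap i j)
  rw [hswap, Equiv.Perm.sign_swap hij] at h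
  push_cast at h
  have h2 : (2 : R) * kernel R X m Y = 0 := by
    rw [two_mul]
    nth_rewrite 1 [h]
    ring
  have hhalf : algebraMap ℚ R (1 / 2) * (2 : R) = 1 := by
    rw [← map_ofNat (algebraMap ℚ R) 2, ← map_mul]
    norm_num
  calc kernel R X m Y = algebraMap ℚ R (1 / 2) * (2 : R) * kernel R X m Y := by rw [hhalf, one_mul]
    _ = algebraMap ℚ R (1 / 2) * ((2 : R) * kernel R X m Y) := by ring
    _ = 0 := by rw [h2, mul_zero]

/-- **The effective action of the block covariance, evaluated on a substituted input, is the substituted effective action of `Mᵀ C′ M`**: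
`effAction (fromBlocks C′ 0 0 0) (Ψ W) = Ψ (effAction (MᵀC′M) W)`, `Ψ = map (toLin′ (fromRows M B))`.
[cite: Salmhofer1999, App. B.2 (B.23)-(B.25)] -/
theorem effAction_fromBlocks_map_fromRows (M : Matrix Γ' Γ R) (B : Matrix ρ Γ R) (C' : Matrix Γ' Γ' R) (W : GrassmannAlgebra R Γ) :
    effAction R (Matrix.fromBlocks C' (0 : Matrix Γ' ρ R) (0 : Matrix ρ Γ' R) (0 : Matrix ρ ρ R)) (ExteriorAlgebra.map (Matrix.toLin' (Matrix.fromRows M B)) W) =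
      ExteriorAlgebra.map (Matrix.toLin' (Matrix.fromRows M B)) (effAction R (M.transpose * C' * M) W) := by
  rw [effAction_map, LinearMap.toMatrix'_toLin', fromRows_transpose_mul_fromBlocks_mul_fromRows]

/-- The same for the Gaussian convolution: `μ_{fromBlocks C′ 0 0 0} ⋆ (Ψ a) = Ψ (μ_{MᵀC′M} ⋆ a)`. [cite: Salmhofer1999, §2.5.1 (2.105)] -/
theorem gaussConv_fromBlocks_map_fromRows (M : Matrix Γ' Γ R) (B : Matrix ρ Γ R) (C' : Matrix Γ' Γ' R) (a : GrassmannAlgebra R Γ) :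
    gaussConv R (Matrix.fromBlocks C' (0 : Matrix Γ' ρ R) (0 : Matrix ρ Γ' R) (0 : Matrix ρ ρ R)) (ExteriorAlgebra.map (Matrix.toLin' (Matrix.fromRows M B)) a) =
      ExteriorAlgebra.map (Matrix.toLin' (Matrix.fromRows M B)) (gaussConv R (M.transpose * C' * M) a) := by
  rw [gaussConv_map, LinearMap.toMatrix'_toLin', fromRows_transpose_mul_fromBlocks_mul_fromRows]

/-- The same for the Laplacian: `Δ_{fromBlocks C′ 0 0 0} (Ψ a) = Ψ (Δ_{MᵀC′M} a)`. [cite: Salmhofer1999, §4.2.5 (4.70)] -/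
theorem grassmannLaplacian_fromBlocks_map_fromRows (M : Matrix Γ' Γ R) (B : Matrix ρ Γ R) (C' : Matrix Γ' Γ' R) (a : GrassmannAlgebra R Γ) :
    grassmannLaplacian R (Matrix.fromBlocks C' (0 : Matrix Γ' ρ R) (0 : Matrix ρ Γ' R) (0 : Matrix ρ ρ R)) (ExteriorAlgebra.map (Matrix.toLin' (Matrix.fromRows M B)) a) =
      ExteriorAlgebra.map (Matrix.toLin' (Matrix.fromRows M B)) (grassmannLaplacian R (M.transpose * C' * M) a) := by
  rw [grassmannLaplacian_map, LinearMap.toMatrix'_toLin', fromRows_transpose_mul_fromBlocks_mul_fromRows]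

omit [Fintype Γ'] [Fintype ρ] in
/-- **The mixed kernels of a substituted element**: `kernel_m (Ψ X) Z = Σ_Y (∏_i (fromRows M B) (Z i) (Y i)) · kernel_m X Y` — a leg `Z i = inl σ`
carries the substitution weight `M σ (Y i)`, a leg `Z i = inr a` the spectator weight `B a (Y i)`. [cite: Salmhofer1999, App. B.2 (B.23)-(B.25)] -/
theorem kernel_map_fromRows (M : Matrix Γ' Γ R) (B : Matrix ρ Γ R) (X : GrassmannAlgebra R Γ) (m : ℕ) (Z : Fin m → Γ' ⊕ ρ) :
    kernel R (ExteriorAlgebra.map (Matrix.toLin' (Matrix.fromRows M B)) X) m Z =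
      ∑ Y : Fin m → Γ, (∏ i, Matrix.fromRows M B (Z i) (Y i)) * kernel R X m Y := by
  rw [kernel_map, LinearMap.toMatrix'_toLin']

omit [Fintype Γ'] [Fintype ρ] in
/-- **Reading an all-spectator string returns the plain kernel at the spectator positions**: with the spectator rows `B a q = [p a = q]`,
`kernel_m (Ψ_p X) (inr ∘ a) = kernel_m X (p ∘ a)` for every `a : Fin m → ρ`. [cite: Salmhofer1999, App. B.2 (B.23)-(B.25)] -/
theorem kernel_map_fromRows_spectator_inr (M : Matrix Γ' Γ R) (p : ρ → Γ) (X : GrassmannAlgebra R Γ) (m : ℕ) (a : Fin m → ρ) :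
    kernel R (ExteriorAlgebra.map (Matrix.toLin' (Matrix.fromRows M (Matrix.of fun b q => if p b = q then (1 : R) else 0))) X) m
        (Sum.inr ∘ a) = kernel R X m (p ∘ a) := by
  rw [kernel_map_fromRows, Finset.sum_eq_single (p ∘ a)]
  · simp [Matrix.fromRows_apply_inr]
  · intro Y _ hY
    obtain ⟨i, hi⟩ : ∃ i, p (a i) ≠ Y i := by
      by_contra h
      push Not at h
      exact hY (funext fun i => (h i).symm)
    rw [Finset.prod_eq_zero (Finset.mem_univ i) (by simp [Matrix.fromRows_apply_inr, hi]), zero_mul]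
  · exact fun h => (h (Finset.mem_univ _)).elim

/-- **THE SPECTATOR READ-OUT OF A GAUSSIAN STEP**: if `C = MᵀC′M` then, for every spectator family `p : ρ → Γ` and every `a : Fin m → ρ`,
`kernel_m (effAction C W) (p ∘ a) = kernel_m (effAction (fromBlocks C′ 0 0 0) (Ψ_p W)) (inr ∘ a)` — the plain legs `p (a i)` of the step's output
are the spectator legs of the step in the enlarged algebra, whose vertex `Ψ_p W` has mixed kernels and whose lines join `Γ′`-legs only.
[cite: BenfattoGiulianiMastropietro2006, §2.7 (2.70)-(2.71)] -/
theorem kernel_effAction_eq_spectator (M : Matrix Γ' Γ R) (C' : Matrix Γ' Γ' R) (p : ρ → Γ) (W : GrassmannAlgebra R Γ) (m : ℕ)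
    (a : Fin m → ρ) :
    kernel R (effAction R (M.transpose * C' * M) W) m (p ∘ a) =
      kernel R (effAction R (Matrix.fromBlocks C' (0 : Matrix Γ' ρ R) (0 : Matrix ρ Γ' R) (0 : Matrix ρ ρ R))
        (ExteriorAlgebra.map (Matrix.toLin' (Matrix.fromRows M (Matrix.of fun b q => if p b = q then (1 : R) else 0))) W)) m
        (Sum.inr ∘ a) := by
  rw [effAction_fromBlocks_map_fromRows, kernel_map_fromRows_spectator_inr]

/-- The spectator read-out of the Gaussian convolution: `kernel_m (μ_C ⋆ W) (p ∘ a) = kernel_m (μ_{fromBlocks C′ 0 0 0} ⋆ Ψ_p W) (inr ∘ a)`.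
[cite: BenfattoGiulianiMastropietro2006, §2.2 (2.12)] -/
theorem kernel_gaussConv_eq_spectator (M : Matrix Γ' Γ R) (C' : Matrix Γ' Γ' R) (p : ρ → Γ) (W : GrassmannAlgebra R Γ) (m : ℕ)
    (a : Fin m → ρ) :
    kernel R (gaussConv R (M.transpose * C' * M) W) m (p ∘ a) =
      kernel R (gaussConv R (Matrix.fromBlocks C' (0 : Matrix Γ' ρ R) (0 : Matrix ρ Γ' R) (0 : Matrix ρ ρ R))
        (ExteriorAlgebra.map (Matrix.toLin' (Matrix.fromRows M (Matrix.of fun b q => if p b = q then (1 : R) else 0))) W)) m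
        (Sum.inr ∘ a) := by
  rw [gaussConv_fromBlocks_map_fromRows, kernel_map_fromRows_spectator_inr]

/-- The spectator read-out of the Laplacian (the ONE-LINE / tadpole piece): `kernel_m (Δ_C W) (p ∘ a) = kernel_m (Δ_{fromBlocks C′ 0 0 0} (Ψ_p W)) (inr ∘ a)`.
[cite: BenfattoGiulianiMastropietro2006, §2.7 (2.70)-(2.71)] -/
theorem kernel_grassmannLaplacian_eq_spectator (M : Matrix Γ' Γ R) (C' : Matrix Γ' Γ' R) (p : ρ → Γ) (W : GrassmannAlgebra R Γ) (m : ℕ)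
    (a : Fin m → ρ) :
    kernel R (grassmannLaplacian R (M.transpose * C' * M) W) m (p ∘ a) =
      kernel R (grassmannLaplacian R (Matrix.fromBlocks C' (0 : Matrix Γ' ρ R) (0 : Matrix ρ Γ' R) (0 : Matrix ρ ρ R))
        (ExteriorAlgebra.map (Matrix.toLin' (Matrix.fromRows M (Matrix.of fun b q => if p b = q then (1 : R) else 0))) W)) m
        (Sum.inr ∘ a) := by
  rw [grassmannLaplacian_fromBlocks_map_fromRows, kernel_map_fromRows_spectator_inr]

omit [Fintype Γ'] [Fintype ρ] in
/-- The input itself: `kernel_m W (p ∘ a) = kernel_m (Ψ_p W) (inr ∘ a)`. [cite: Salmhofer1999, App. B.2 (B.23)-(B.25)] -/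
theorem kernel_eq_spectator (M : Matrix Γ' Γ R) (p : ρ → Γ) (W : GrassmannAlgebra R Γ) (m : ℕ) (a : Fin m → ρ) :
    kernel R W m (p ∘ a) =
      kernel R (ExteriorAlgebra.map (Matrix.toLin' (Matrix.fromRows M (Matrix.of fun b q => if p b = q then (1 : R) else 0))) W) m
        (Sum.inr ∘ a) := by
  rw [kernel_map_fromRows_spectator_inr]

/-- **The `≥ 2`-self-line piece through spectators**: `kernel_m (e^{Δ_C}W − W − Δ_C W) (p ∘ a)` equals the same kernel of the enlarged step on `Ψ_p W`
read at `inr ∘ a`. [cite: BenfattoGiulianiMastropietro2006, §2.7 (2.70)-(2.71)] -/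
theorem kernel_gaussConv_sub_sub_laplacian_eq_spectator (M : Matrix Γ' Γ R) (C' : Matrix Γ' Γ' R) (p : ρ → Γ) (W : GrassmannAlgebra R Γ)
    (m : ℕ) (a : Fin m → ρ) :
    kernel R (gaussConv R (M.transpose * C' * M) W - W - grassmannLaplacian R (M.transpose * C' * M) W) m (p ∘ a) =
      kernel R (gaussConv R (Matrix.fromBlocks C' (0 : Matrix Γ' ρ R) (0 : Matrix ρ Γ' R) (0 : Matrix ρ ρ R))
          (ExteriorAlgebra.map (Matrix.toLin' (Matrix.fromRows M (Matrix.of fun b q => if p b = q then (1 : R) else 0))) W) -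
        ExteriorAlgebra.map (Matrix.toLin' (Matrix.fromRows M (Matrix.of fun b q => if p b = q then (1 : R) else 0))) W -
        grassmannLaplacian R (Matrix.fromBlocks C' (0 : Matrix Γ' ρ R) (0 : Matrix ρ Γ' R) (0 : Matrix ρ ρ R))
          (ExteriorAlgebra.map (Matrix.toLin' (Matrix.fromRows M (Matrix.of fun b q => if p b = q then (1 : R) else 0))) W)) m
        (Sum.inr ∘ a) := by
  rw [kernel_sub_gen, kernel_sub_gen, kernel_sub_gen, kernel_sub_gen, kernel_gaussConv_eq_spectator, kernel_grassmannLaplacian_eq_spectator,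
    kernel_eq_spectator R M p W]

/-- **The `≥ 2`-vertex piece through spectators**: `kernel_m (effAction C W − e^{Δ_C}W) (p ∘ a)` equals the same kernel of the enlarged step on `Ψ_p W`
read at `inr ∘ a` — the left side of `sum_[wt_]norm_kernel_effAction_sub_gaussConv_le[_graded_prescribed]_of_gramBounded` in the enlarged algebra.
[cite: BenfattoGiulianiMastropietro2006, §2.7 (2.70)-(2.71)] -/
theorem kernel_effAction_sub_gaussConv_eq_spectator (M : Matrix Γ' Γ R) (C' : Matrix Γ' Γ' R) (p : ρ → Γ) (W : GrassmannAlgebra R Γ) (m : ℕ)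
    (a : Fin m → ρ) :
    kernel R (effAction R (M.transpose * C' * M) W - gaussConv R (M.transpose * C' * M) W) m (p ∘ a) =
      kernel R (effAction R (Matrix.fromBlocks C' (0 : Matrix Γ' ρ R) (0 : Matrix ρ Γ' R) (0 : Matrix ρ ρ R))
          (ExteriorAlgebra.map (Matrix.toLin' (Matrix.fromRows M (Matrix.of fun b q => if p b = q then (1 : R) else 0))) W) -
        gaussConv R (Matrix.fromBlocks C' (0 : Matrix Γ' ρ R) (0 : Matrix ρ Γ' R) (0 : Matrix ρ ρ R))
          (ExteriorAlgebra.map (Matrix.toLin' (Matrix.fromRows M (Matrix.of fun b q => if p b = q then (1 : R) else 0))) W)) m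
        (Sum.inr ∘ a) := by
  rw [kernel_sub_gen, kernel_sub_gen, kernel_effAction_eq_spectator, kernel_gaussConv_eq_spectator]

omit [Fintype Γ'] [Fintype ρ] in
/-- **A kernel of the substituted element with two legs on the SAME spectator vanishes** (`θ_a² = 0`): if `Z i = inr b = Z j` for `i ≠ j` then
`kernel_m (Ψ_p X) Z = 0` — so with `ρ = Fin r` at most `r` spectator (plain) legs occur in any kernel of `Ψ_p X`. [cite: Salmhofer1999, §4.3 (4.95)] -/
theorem kernel_map_fromRows_eq_zero_of_spectator_repeat (M : Matrix Γ' Γ R) (p : ρ → Γ) (X : GrassmannAlgebra R Γ) (m : ℕ)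
    (Z : Fin m → Γ' ⊕ ρ) {i j : Fin m} (hij : i ≠ j) {b : ρ} (hi : Z i = Sum.inr b) (hj : Z j = Sum.inr b) :
    kernel R (ExteriorAlgebra.map (Matrix.toLin' (Matrix.fromRows M (Matrix.of fun b q => if p b = q then (1 : R) else 0))) X) m Z = 0 := by
  rw [kernel_map_fromRows]
  refine Finset.sum_eq_zero fun Y _ => ?_
  by_cases hYi : Y i = p b
  · by_cases hYj : Y j = p b
    · -- both legs sit at `p b`: the plain kernel has a repeated label
      rw [kernel_eq_zero_of_not_injective R X (fun hinj => hij (hinj (hYi.trans hYj.symm))), mul_zero]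
    · rw [Finset.prod_eq_zero (Finset.mem_univ j) (by rw [hj, Matrix.fromRows_apply_inr, Matrix.of_apply, if_neg (Ne.symm hYj)]), zero_mul]
  · rw [Finset.prod_eq_zero (Finset.mem_univ i) (by rw [hi, Matrix.fromRows_apply_inr, Matrix.of_apply, if_neg (Ne.symm hYi)]), zero_mul]

end Spectator

end Literature.MathematicalPhysics.QuantumLattice

end
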